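import Literature.NumberTheory.Li1992.RallisKernelIdentity
import Literature.NumberTheory.Li1992.RallisDoubledPairCarriers
import Literature.NumberTheory.Li1992.SchwartzPairingPolarization
import Literature.NumberTheory.Li1992.RallisOrbitSumDescent
import Literature.NumberTheory.Weil1964.AdelicDoublingOriginValueInvariance
import Literature.NumberTheory.Automorphic.UnitaryGroupArchCompactTotallyComplex
import Summits.HodgeConjecture.HodgeConjecture.Theorems.H413E2SWDiagonalSeesaw
import Summits.HodgeConjecture.HodgeConjecture.Theorems.H413E2SWSectionValue
import Summits.HodgeConjecture.HodgeConjecture.Theorems.H413E2SWOrbit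
import Summits.HodgeConjecture.HodgeConjecture.Theorems.H413E2SW2FinLevelEigen
import HarnessLib

/-!
# Crux H413, engine E-2: Rallis' formula in KERNEL FORM at rank one FROM THE SIEGEL–WEIL IDENTITY — the E-2 child line's composition
# (`Cruxes/H413/Lines/F0_E2SiegelWeilWeilRange.lean`, ED. 8∕9) PORTED to `Theorems/` over the ★ stub closers and the ★ carriers

HC_CM is proved only modulo the printed citations until rung 0 closes.  Cell `hodgecm-mathlib` (D-0151), programme P4 (socket F0Hocc =
stmt-HodgeConjecture-27457), engine E-2, crux item stmt-HodgeConjecture-24833; author A-p17 (g14) (child-line pen).  WHY: a `Theorems/` file cannot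
import a `Cruxes/…/Lines/` workfile, so the socket closer chain (P4 S6 ← E-2 parent head ← E-2 child head) needs the child's composition at
`Theorems/` level.  It is kernel-checked HERE over the ★ closers (SW0∕SW1 ★ p799845, SW2(i) ★ p799882, SW2(ii) ★ p804072 + ★ p803284, SW3 ★ p803132,
SW4 ★ p802010), re-spelled in §0 over the ★ carriers `Li1992.DoubledPair.*` (each `:= closer`, one δ-unfolding — exactly the line's folds), with the ONE
open letter of the E-2 floor — the Siegel–Weil identity for the doubled pair `(U(J_V), U(J_W ⊕ᶠ −J_W))` in Weil's range [Weil1965, Thm. 5 (p. 76)], the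
child's `StubSW2iii` BY NAME — as the explicit hypothesis `hSW` (SW4 recipe: elaborates today; discharged by ONE application when the Siegel–Weil closer
lands).  Sequel `Theorems/H413E2RallisRankOneOfKernel.lean` turns the conclusion into [Li1992, Thm 2.1] at rank one.  No `def`, no `sorry`, no `Lines` import.

* §0 `sw0_diagChar`, `sw1_seesawKernel`, `sw2ii_orbitalSums`, `sw3_orbit`, `sw4_sectionValue`, `sw2i_carrier` — the ★ closers over the ★ carriers;
* §1 **`kernelRallisIdentityCM_of_siegelWeil (hSW) : Li1992.KernelRallisIdentityUnitaryRankOneCM`** — [Li1992, (24)–(25) p. 184]: `Ψ := (ω(x₁⁻¹)Φ₁) ⊠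
  conj(ω(x₂⁻¹)Φ₂)`; SW1(SW0) `K = I□(Ψ)`; SW2(iii) `= κ Σ' f_Ψ`; SW3 reindexes over `U(J_W)(F)`, SW2(i) kills the representative defect, SW4 gives
  `f_Ψ(⟦mγ⟧) = c₀⟨ω(γ⁻¹x₁⁻¹)Φ₁, ω(x₂⁻¹)Φ₂⟩`, polarised `hiso` rewrites to the word `x₂γx₁⁻¹`; BOUND = SW2(ii) on compacta + ★ `OrbitSumDescent`.

## References
[Li1992] (13) p. 181–182, (24)–(25) p. 184 · [Weil1965] n° 39 (30) p. 55, n° 40 Thm. 1 (p. 57), Thm. 5 (p. 76) · [HarrisKudlaSweet1996] §1 (1.2)–(1.5) ·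
[Kudla1994] Thm. 3.1 · [Kudla1984] §1.
-/

set_option autoImplicit false

noncomputable section

-- Mathlib's measure ∕ quotient APIs are stated across semireducible wrappers (as in the E-2 lines and ★ `Li1992/RallisKernelIdentity`).
set_option backward.isDefEq.respectTransparency false
set_option linter.dupNamespace false

namespace Summit.HodgeConjecture.HodgeConjecture.Cruxes.H413.E2SiegelWeil

open scoped Matrix ComplexConjugate ENNReal ComplexOrder
open _root_.MeasureTheory NumberField
open Literature.RepresentationTheory.HeisenbergGroup
open Literature.NumberTheory.Weil1964 Literature.NumberTheory.Automorphic
open Literature.NumberTheory.GelbartRogawski1991 Literature.NumberTheory.GelbartRogawski1991.UnitaryDualPair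
open Literature.NumberTheory.Li1992 Literature.NumberTheory.Li1992.DoubledPair

/-! ## §0 The ★ stub closers RE-SPELLED over the ★ carriers `Li1992.DoubledPair.*` (each is its closer by δ — one definitional unfolding, as in the line's folds) -/

/-- **SW0 — the diagonal see-saw is twist-free** — the child line's `StubSW0` over the ★ carriers, CLOSED by ★ `E2SWDiagonalSeesaw.sw0_diagChar`. [cite: Kudla1994, Thm. 3.1 p. 378] [cite: Li1992, p. 181] -/
theorem sw0_diagChar :
    ∀ (F E : Type) [Field F] [NumberField F] [Field E] [NumberField E] [Algebra F E]
      (c : E ≃ₐ[F] E) (N : ℕ) {n : ℕ} (e : Fin N × Fin 1 ≃ Fin n)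
      {TV : Matrix (Fin N) (Fin N) F} {TW : Matrix (Fin 1) (Fin 1) F}
      [Algebra.IsQuadraticExtension F E] {δ : E} (hcδ : c δ = -δ) (hδ : δ ≠ 0) {d : F}
      (hd : δ * δ = algebraMap F E d) (hV : TV.IsSymm) (hW : TW.IsSymm) (hVd : IsUnit TV.det) (hWd : IsUnit TW.det)
      [LocallyCompactSpace (UnitaryGroup.adelic F E c N (TV.map (algebraMap F E)))]
      [LocallyCompactSpace (UnitaryGroup.adelic F E c 1 (TW.map (algebraMap F E)))]
      (s : UnitaryGroup.adelicPair F E c N 1 (TV.map (algebraMap F E)) (TW.map (algebraMap F E)) →*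
        adelicMpCont F (Fin n) (adelicGram F e TV TW))
      (hs : (splittingDatum F E c N 1 e (TV.map (algebraMap F E)) (TW.map (algebraMap F E)) hcδ hδ hd hV hW hVd hWd rfl rfl).IsCompatible s)
      [MeasurableSpace (AdeleRing (𝓞 F) F)] [BorelSpace (AdeleRing (𝓞 F) F)]
      (νX : Measure (Fin n → AdeleRing (𝓞 F) F)) [νX.IsAddHaarMeasure]
      (hiso : ∀ (p : UnitaryGroup.adelic F E c N (TV.map (algebraMap F E)) × UnitaryGroup.adelic F E c 1 (TW.map (algebraMap F E)))
          (Φ : piSchwartzBruhat F (Fin n)),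
        ∫⁻ x, ‖((pairRep F E c N 1 e (TV.map (algebraMap F E)) (TW.map (algebraMap F E)) s) p Φ :
            (Fin n → AdeleRing (𝓞 F) F) → ℂ) x‖ₑ ^ 2 ∂νX =
          ∫⁻ x, ‖(Φ : (Fin n → AdeleRing (𝓞 F) F) → ℂ) x‖ₑ ^ 2 ∂νX),
      ∀ (g : UnitaryGroup.adelic F E c N (TV.map (algebraMap F E))) (Φ₁ Φ₂ : piSchwartzBruhat F (Fin n)),
        adelicMpCont.omega F (Fin (n + n)) (doubledGramFin F (adelicGram F e TV TW))
            (vDiagLift F E c hcδ hδ hd N e TV hV hVd TW hW hWd g) (boxConj F Φ₁ Φ₂) =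
          boxConj F ((pairRep F E c N 1 e (TV.map (algebraMap F E)) (TW.map (algebraMap F E)) s) (g, 1) Φ₁) ((pairRep F E c N 1 e (TV.map (algebraMap F E)) (TW.map (algebraMap F E)) s) (g, 1) Φ₂) :=
  E2SWDiagonalSeesaw.sw0_diagChar

/-- **SW1 — the see-saw with absorbed translates, given SW0** — the child line's `StubSW1` over the ★ carriers, CLOSED by ★ `E2SWDiagonalSeesaw.sw1_seesawKernel`. [cite: Kudla1984, §1] [cite: Li1992, (24) p. 184] -/
theorem sw1_seesawKernel :
    ∀ (F E : Type) [Field F] [NumberField F] [Field E] [NumberField E] [Algebra F E]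
      (c : E ≃ₐ[F] E) (N : ℕ) {n : ℕ} (e : Fin N × Fin 1 ≃ Fin n)
      {TV : Matrix (Fin N) (Fin N) F} {TW : Matrix (Fin 1) (Fin 1) F}
      [Algebra.IsQuadraticExtension F E] {δ : E} (hcδ : c δ = -δ) (hδ : δ ≠ 0) {d : F}
      (hd : δ * δ = algebraMap F E d) (hV : TV.IsSymm) (hW : TW.IsSymm) (hVd : IsUnit TV.det) (hWd : IsUnit TW.det)
      [LocallyCompactSpace (UnitaryGroup.adelic F E c N (TV.map (algebraMap F E)))]
      [LocallyCompactSpace (UnitaryGroup.adelic F E c 1 (TW.map (algebraMap F E)))]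
      (s : UnitaryGroup.adelicPair F E c N 1 (TV.map (algebraMap F E)) (TW.map (algebraMap F E)) →*
        adelicMpCont F (Fin n) (adelicGram F e TV TW))
      (hs : (splittingDatum F E c N 1 e (TV.map (algebraMap F E)) (TW.map (algebraMap F E)) hcδ hδ hd hV hW hVd hWd rfl rfl).IsCompatible s)
      (hρ : HasThetaMajorants fun (p : UnitaryGroup.adelic F E c N (TV.map (algebraMap F E)) ×
          UnitaryGroup.adelic F E c 1 (TW.map (algebraMap F E))) (Φ : piSchwartzBruhat F (Fin n)) =>
        pairRep F E c N 1 e (TV.map (algebraMap F E)) (TW.map (algebraMap F E)) s p Φ)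
      (SK : Set (piSchwartzBruhat F (Fin n)))
      (hSK : ∀ (h : UnitaryGroup.adelic F E c 1 (TW.map (algebraMap F E))) (Φ : piSchwartzBruhat F (Fin n)), Φ ∈ SK →
        pairRep F E c N 1 e (TV.map (algebraMap F E)) (TW.map (algebraMap F E)) s (1, h) Φ ∈ SK)
      [CompactSpace (UnitaryGroup.adelic F E c N (TV.map (algebraMap F E)) ⧸
        (UnitaryGroup.toAdelic F E c N (TV.map (algebraMap F E))).range)]
      [CompactSpace (UnitaryGroup.adelic F E c 1 (TW.map (algebraMap F E)) ⧸
        (UnitaryGroup.toAdelic F E c 1 (TW.map (algebraMap F E))).range)]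
      [MeasurableSpace (UnitaryGroup.adelic F E c N (TV.map (algebraMap F E)) ⧸
        (UnitaryGroup.toAdelic F E c N (TV.map (algebraMap F E))).range)]
      [BorelSpace (UnitaryGroup.adelic F E c N (TV.map (algebraMap F E)) ⧸
        (UnitaryGroup.toAdelic F E c N (TV.map (algebraMap F E))).range)]
      (ν : Measure (UnitaryGroup.adelic F E c N (TV.map (algebraMap F E)) ⧸
        (UnitaryGroup.toAdelic F E c N (TV.map (algebraMap F E))).range))
      [IsFiniteMeasure ν] [ν.IsOpenPosMeasure]
      [SMulInvariantMeasure (UnitaryGroup.adelic F E c N (TV.map (algebraMap F E)))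
        (UnitaryGroup.adelic F E c N (TV.map (algebraMap F E)) ⧸ (UnitaryGroup.toAdelic F E c N (TV.map (algebraMap F E))).range) ν],
      (∀ (g : UnitaryGroup.adelic F E c N (TV.map (algebraMap F E))) (Φ₁ Φ₂ : piSchwartzBruhat F (Fin n)),
        adelicMpCont.omega F (Fin (n + n)) (doubledGramFin F (adelicGram F e TV TW))
            (vDiagLift F E c hcδ hδ hd N e TV hV hVd TW hW hWd g) (boxConj F Φ₁ Φ₂) =
          boxConj F ((pairRep F E c N 1 e (TV.map (algebraMap F E)) (TW.map (algebraMap F E)) s) (g, 1) Φ₁) ((pairRep F E c N 1 e (TV.map (algebraMap F E)) (TW.map (algebraMap F E)) s) (g, 1) Φ₂)) →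
      ∀ (Φ₁ Φ₂ : piSchwartzBruhat F (Fin n)) (x₁ x₂ : UnitaryGroup.adelic F E c 1 (TW.map (algebraMap F E))),
        (thetaKernelDatum F E c N 1 e (TV.map (algebraMap F E)) (TW.map (algebraMap F E)) hcδ hδ hd hV hW hVd hWd rfl rfl s hs hρ SK hSK).innerKernel ν Φ₁ Φ₂ (x₁ : UnitaryGroup.adelic F E c 1 (TW.map (algebraMap F E)) ⧸ _)
            (x₂ : UnitaryGroup.adelic F E c 1 (TW.map (algebraMap F E)) ⧸ _) =
          doubledThetaIntegral F E c hcδ hδ hd N e TV hV hVd TW hW hWd ν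
            (boxConj F ((pairRep F E c N 1 e (TV.map (algebraMap F E)) (TW.map (algebraMap F E)) s) (1, x₁⁻¹) Φ₁) ((pairRep F E c N 1 e (TV.map (algebraMap F E)) (TW.map (algebraMap F E)) s) (1, x₂⁻¹) Φ₂)) :=
  E2SWDiagonalSeesaw.sw1_seesawKernel

/-- **SW2(ii) — the orbital sums converge uniformly on compacta (given `hF`)** — the child line's `StubSW2ii` over the ★ carriers, CLOSED by ★ `E2SW2OrbitalSums.orbitalSums_bounded_of_finIntegrable′ + UnitaryGroup.compactSpace_arch_rankOne`. [cite: Weil1965, n° 40 Thm. 1 (p. 57)] [cite: Li1992, (24)–(25) p. 184] -/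
theorem sw2ii_orbitalSums :
    ∀ (F E : Type) [Field F] [NumberField F] [Field E] [NumberField E] [Algebra F E]
      (c : E ≃ₐ[F] E) (N : ℕ) {n : ℕ} (e : Fin N × Fin 1 ≃ Fin n)
      {TV : Matrix (Fin N) (Fin N) F} {TW : Matrix (Fin 1) (Fin 1) F}
      [Algebra.IsQuadraticExtension F E] [IsTotallyReal F] [IsTotallyComplex E]
      {δ : E} (hcδ : c δ = -δ) (hδ : δ ≠ 0) {d : F}
      (hd : δ * δ = algebraMap F E d) (hV : TV.IsSymm) (hW : TW.IsSymm) (hVd : IsUnit TV.det) (hWd : IsUnit TW.det)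
      (s : UnitaryGroup.adelicPair F E c N 1 (TV.map (algebraMap F E)) (TW.map (algebraMap F E)) →*
        adelicMpCont F (Fin n) (adelicGram F e TV TW))
      (hs : (splittingDatum F E c N 1 e (TV.map (algebraMap F E)) (TW.map (algebraMap F E)) hcδ hδ hd hV hW hVd hWd rfl rfl).IsCompatible s)
      [MeasurableSpace (AdeleRing (𝓞 F) F)] [BorelSpace (AdeleRing (𝓞 F) F)]
      (νX : Measure (Fin n → AdeleRing (𝓞 F) F)) [νX.IsAddHaarMeasure]
      (hiso : ∀ (p : UnitaryGroup.adelic F E c N (TV.map (algebraMap F E)) × UnitaryGroup.adelic F E c 1 (TW.map (algebraMap F E)))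
          (Φ : piSchwartzBruhat F (Fin n)),
        ∫⁻ x, ‖((pairRep F E c N 1 e (TV.map (algebraMap F E)) (TW.map (algebraMap F E)) s) p Φ :
            (Fin n → AdeleRing (𝓞 F) F) → ℂ) x‖ₑ ^ 2 ∂νX =
          ∫⁻ x, ‖(Φ : (Fin n → AdeleRing (𝓞 F) F) → ℂ) x‖ₑ ^ 2 ∂νX)
      (hF : ∀ [MeasurableSpace (IsDedekindDomain.FiniteAdeleRing (𝓞 F) F)] [BorelSpace (IsDedekindDomain.FiniteAdeleRing (𝓞 F) F)]
        (μf : Measure (Fin n → IsDedekindDomain.FiniteAdeleRing (𝓞 F) F)) [μf.IsAddHaarMeasure]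
        [MeasurableSpace (UnitaryGroup.finAdelic F E c 1 (TW.map (algebraMap F E)))] [BorelSpace (UnitaryGroup.finAdelic F E c 1 (TW.map (algebraMap F E)))]
        (μb : Measure (UnitaryGroup.finAdelic F E c 1 (TW.map (algebraMap F E)))) [μb.IsHaarMeasure] (Φf Ψf : FinSB F (Fin n)),
        Integrable (fun b : UnitaryGroup.finAdelic F E c 1 (TW.map (algebraMap F E)) =>
          ∫ y, ((finSBReindex F e (UnitaryDualPair.WeilCoinv.finPairRep F E c N 1 e (TV.map (algebraMap F E)) (TW.map (algebraMap F E)) hcδ hδ hd hV hW hVd hWd rfl rfl hs (1, b)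
              ((finSBReindex F e).symm Φf)) : FinSB F (Fin n)) : (Fin n → IsDedekindDomain.FiniteAdeleRing (𝓞 F) F) → ℂ) y *
            conj ((Ψf : (Fin n → IsDedekindDomain.FiniteAdeleRing (𝓞 F) F) → ℂ) y) ∂μf) μb)
      (Φ₁ Φ₂ : piSchwartzBruhat F (Fin n)) (C : Set (UnitaryGroup.adelic F E c 1 (TW.map (algebraMap F E)) × UnitaryGroup.adelic F E c 1 (TW.map (algebraMap F E)))),
      IsCompact C → ∃ B : ℝ, ∀ (x₁ x₂ : UnitaryGroup.adelic F E c 1 (TW.map (algebraMap F E))), (x₁, x₂) ∈ C →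
        Summable (fun γ : (UnitaryGroup.toAdelic F E c 1 (TW.map (algebraMap F E))).range =>
          ‖schwartzPairing F (Fin n) νX ((pairRep F E c N 1 e (TV.map (algebraMap F E)) (TW.map (algebraMap F E)) s) (1, (γ : UnitaryGroup.adelic F E c 1 (TW.map (algebraMap F E)))) ((pairRep F E c N 1 e (TV.map (algebraMap F E)) (TW.map (algebraMap F E)) s) (1, x₁⁻¹) Φ₁))
            ((pairRep F E c N 1 e (TV.map (algebraMap F E)) (TW.map (algebraMap F E)) s) (1, x₂⁻¹) Φ₂)‖) ∧
        ∑' γ : (UnitaryGroup.toAdelic F E c 1 (TW.map (algebraMap F E))).range,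
          ‖schwartzPairing F (Fin n) νX ((pairRep F E c N 1 e (TV.map (algebraMap F E)) (TW.map (algebraMap F E)) s) (1, (γ : UnitaryGroup.adelic F E c 1 (TW.map (algebraMap F E)))) ((pairRep F E c N 1 e (TV.map (algebraMap F E)) (TW.map (algebraMap F E)) s) (1, x₁⁻¹) Φ₁))
            ((pairRep F E c N 1 e (TV.map (algebraMap F E)) (TW.map (algebraMap F E)) s) (1, x₂⁻¹) Φ₂)‖ ≤ B := by
  intro F E _ _ _ _ _ c N n e TV TW _ _ _ δ hcδ hδ d hd hV hW hVd hWd s hs _ _ νX _ hiso hF Φ₁ Φ₂ C hC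
  haveI := UnitaryGroup.compactSpace_arch_rankOne F E c (TW.map (algebraMap F E)) hcδ hδ hWd rfl
  exact E2SW2OrbitalSums.orbitalSums_bounded_of_finIntegrable' F E c N e (TV.map (algebraMap F E)) (TW.map (algebraMap F E))
    hcδ hδ hd hV hW hVd hWd rfl rfl hs νX hiso hF Φ₁ Φ₂ C hC

/-- **SW3 — one rational orbit, equivariantly** — the child line's `StubSW3` over the ★ carriers, CLOSED by ★ `E2SWOrbit.sw3_orbit`. [cite: HarrisKudlaSweet1996, §1 (1.2)–(1.3)] -/
theorem sw3_orbit :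
    ∀ (F E : Type) [Field F] [NumberField F] [Field E] [NumberField E] [Algebra F E]
      (c : E ≃ₐ[F] E) (N : ℕ) {n : ℕ} (e : Fin N × Fin 1 ≃ Fin n)
      {TV : Matrix (Fin N) (Fin N) F} {TW : Matrix (Fin 1) (Fin 1) F}
      [Algebra.IsQuadraticExtension F E] {δ : E} (hcδ : c δ = -δ) (hδ : δ ≠ 0) {d : F}
      (hd : δ * δ = algebraMap F E d) (hV : TV.IsSymm) (hW : TW.IsSymm) (hVd : IsUnit TV.det) (hWd : IsUnit TW.det)
      [LocallyCompactSpace (UnitaryGroup.adelic F E c N (TV.map (algebraMap F E)))]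
      [LocallyCompactSpace (UnitaryGroup.adelic F E c 1 (TW.map (algebraMap F E)))]
      (s : UnitaryGroup.adelicPair F E c N 1 (TV.map (algebraMap F E)) (TW.map (algebraMap F E)) →*
        adelicMpCont F (Fin n) (adelicGram F e TV TW))
      (hs : (splittingDatum F E c N 1 e (TV.map (algebraMap F E)) (TW.map (algebraMap F E)) hcδ hδ hd hV hW hVd hWd rfl rfl).IsCompatible s),
      2 < N →
      ∃ m : (UnitaryGroup.toAdelic F E c 1 (TW.map (algebraMap F E))).range → (ratDoubledW F E c hcδ hδ hd N e TV hV hVd TW hW hWd),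
        Function.Bijective (fun γ =>
          (QuotientGroup.mk (m γ) : (ratDoubledW F E c hcδ hδ hd N e TV hV hVd TW hW hWd) ⧸
            (stabDiagRat F N e TV hVd TW hWd).subgroupOf (ratDoubledW F E c hcδ hδ hd N e TV hV hVd TW hW hWd))) ∧
        ∀ (γ : (UnitaryGroup.toAdelic F E c 1 (TW.map (algebraMap F E))).range) (Φ₁ Φ₂ : piSchwartzBruhat F (Fin n)),
          actRat F N e TV hVd TW hWd (m γ : Matrix.symplecticGroup (Fin (n + n)) F) (boxConj F Φ₁ Φ₂) =
            boxConj F ((pairRep F E c N 1 e (TV.map (algebraMap F E)) (TW.map (algebraMap F E)) s) (1, (γ : UnitaryGroup.adelic F E c 1 (TW.map (algebraMap F E)))) Φ₁) Φ₂ :=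
  E2SWOrbit.sw3_orbit

/-- **SW4 — the section value at the origin** — the child line's `StubSW4` over the ★ carriers, CLOSED by ★ `E2SWSectionValue.sw4_sectionValue`. [cite: Li1992, (13) p. 182] -/
theorem sw4_sectionValue :
    ∀ (F : Type) [Field F] [NumberField F] (N : ℕ) {n : ℕ} (e : Fin N × Fin 1 ≃ Fin n)
      {TV : Matrix (Fin N) (Fin N) F} {TW : Matrix (Fin 1) (Fin 1) F} (hVd : IsUnit TV.det) (hWd : IsUnit TW.det)
      [MeasurableSpace (AdeleRing (𝓞 F) F)] [BorelSpace (AdeleRing (𝓞 F) F)]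
      (νX : Measure (Fin n → AdeleRing (𝓞 F) F)) [νX.IsAddHaarMeasure],
      ∃ c₀ : ℝ, 0 < c₀ ∧ ∀ (Φ₁ Φ₂ : piSchwartzBruhat F (Fin n)),
        ev0 F N e TV hVd TW hWd (boxConj F Φ₁ Φ₂) = (c₀ : ℂ) * schwartzPairing F (Fin n) νX Φ₁ Φ₂ :=
  E2SWSectionValue.sw4_sectionValue

/-- **SW2(i) — the Siegel–Eisenstein carrier** — the child line's `StubSW2i` over the ★ carriers, CLOSED by ★ `Weil1964.omega_doublingDeltaLift_omega_ratThetaLiftCont_apply_zero`. [cite: Weil1965, n° 39 (30) p. 55] [cite: Li1992, p. 181] -/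
theorem sw2i_carrier :
    ∀ (F : Type) [Field F] [NumberField F] (N : ℕ) {n : ℕ} (e : Fin N × Fin 1 ≃ Fin n)
      {TV : Matrix (Fin N) (Fin N) F} {TW : Matrix (Fin 1) (Fin 1) F} (hVd : IsUnit TV.det) (hWd : IsUnit TW.det),
      SiegelEisensteinCarrier (Matrix.symplecticGroup (Fin (n + n)) F) (piSchwartzBruhat F (Fin (n + n)))
        (actRat F N e TV hVd TW hWd) (stabDiagRat F N e TV hVd TW hWd) (ev0 F N e TV hVd TW hWd) := by
  intro F _ _ N n e TV TW hVd hWd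
  exact ⟨fun p hp Ψ => omega_doublingDeltaLift_omega_ratThetaLiftCont_apply_zero F (adelicGram F e TV TW)
    (isUnit_det_adelicGram F e hVd hWd) p (Subgroup.mem_comap.mp (Subgroup.mem_comap.mp hp)) Ψ⟩

/-! ## §1 The child composition: Siegel–Weil (hypothesis) + the five ★ closers ⇒ Rallis' formula in kernel form -/

/-- **RALLIS' FORMULA IN KERNEL FORM (rank one, CM quadratic `E/F`, `J_V` definite at one archimedean place, `N > 2`) FROM THE SIEGEL–WEIL
IDENTITY ALONE** — the E-2 child line's kernel-checked composition `kernelRallisIdentity_of` PORTED to `Theorems/`: every stub except SW2(iii) is a ★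
closer BY NAME (SW0∕SW1 ★ p799845 `E2SWDiagonalSeesaw.sw0_diagChar ∕ sw1_seesawKernel`, SW2(i) ★ p799882 `Weil1964.omega_doublingDeltaLift_omega_ratThetaLiftCont_apply_zero`,
SW2(ii) ★ p804072 `E2SW2OrbitalSums.orbitalSums_bounded_of_finIntegrable'` with ★ p803284 `UnitaryGroup.compactSpace_arch_rankOne`, SW3 ★ p803132 `E2SWOrbit.sw3_orbit`,
SW4 ★ p802010 `E2SWSectionValue.sw4_sectionValue`), and the one open letter — the Siegel–Weil identity for the doubled pair in Weil's range
([Weil1965, Thm. 5 (p. 76)]: `∃ κ > 0, ∀ Ψ, Summable (eisSection …) ∧ I□ Ψ = κ · eis … Ψ`, the child's `StubSW2iii` VERBATIM over the ★ carriers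
`Li1992.DoubledPair.*`) — is the HYPOTHESIS `hSW`.  Proof = [Li1992, (24)–(25) p. 184]: `Ψ := (ω(x₁⁻¹)Φ₁) ⊠ conj(ω(x₂⁻¹)Φ₂)`; SW1(SW0) `K = I□(Ψ)`; SW2(iii)
`= κ Σ' f_Ψ`; SW3 reindexes over `U(J_W)(F)`, SW2(i) kills the representative defect, SW4 evaluates `f_Ψ(⟦mγ⟧) = c₀⟨ω(γ⁻¹x₁⁻¹)Φ₁, ω(x₂⁻¹)Φ₂⟩`, polarised
`hiso` rewrites to the word `x₂γx₁⁻¹`; BOUND = SW2(ii) on compacta + ★ `OrbitSumDescent`.  Conditional on `hSW` only; HC_CM is proved only modulo the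
printed citations until rung 0 closes. [cite: Li1992, (24)–(25) p. 184] [cite: Weil1965, Thm. 5 (p. 76)] [cite: HarrisKudlaSweet1996, §1 (1.2)–(1.5)] -/
theorem kernelRallisIdentityCM_of_siegelWeil (hSW :
      ∀ (F E : Type) [Field F] [NumberField F] [Field E] [NumberField E] [Algebra F E]
        (c : E ≃ₐ[F] E) (N : ℕ) {n : ℕ} (e : Fin N × Fin 1 ≃ Fin n)
        {TV : Matrix (Fin N) (Fin N) F} {TW : Matrix (Fin 1) (Fin 1) F}
        [Algebra.IsQuadraticExtension F E]
        [IsTotallyReal F] [IsTotallyComplex E] (τ : E →+* ℂ) (hτ : ((TV.map (algebraMap F E)).map τ).PosDef)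
        {δ : E} (hcδ : c δ = -δ) (hδ : δ ≠ 0) {d : F}
        (hd : δ * δ = algebraMap F E d) (hV : TV.IsSymm) (hW : TW.IsSymm) (hVd : IsUnit TV.det) (hWd : IsUnit TW.det)
        [LocallyCompactSpace (UnitaryGroup.adelic F E c N (TV.map (algebraMap F E)))]
        [LocallyCompactSpace (UnitaryGroup.adelic F E c 1 (TW.map (algebraMap F E)))]
        (s : UnitaryGroup.adelicPair F E c N 1 (TV.map (algebraMap F E)) (TW.map (algebraMap F E)) →*
          adelicMpCont F (Fin n) (adelicGram F e TV TW))
        (hs : (splittingDatum F E c N 1 e (TV.map (algebraMap F E)) (TW.map (algebraMap F E)) hcδ hδ hd hV hW hVd hWd rfl rfl).IsCompatible s)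
        [CompactSpace (UnitaryGroup.adelic F E c N (TV.map (algebraMap F E)) ⧸
          (UnitaryGroup.toAdelic F E c N (TV.map (algebraMap F E))).range)]
        [CompactSpace (UnitaryGroup.adelic F E c 1 (TW.map (algebraMap F E)) ⧸
          (UnitaryGroup.toAdelic F E c 1 (TW.map (algebraMap F E))).range)]
        [MeasurableSpace (UnitaryGroup.adelic F E c N (TV.map (algebraMap F E)) ⧸
          (UnitaryGroup.toAdelic F E c N (TV.map (algebraMap F E))).range)]
        [BorelSpace (UnitaryGroup.adelic F E c N (TV.map (algebraMap F E)) ⧸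
          (UnitaryGroup.toAdelic F E c N (TV.map (algebraMap F E))).range)]
        (ν : Measure (UnitaryGroup.adelic F E c N (TV.map (algebraMap F E)) ⧸
          (UnitaryGroup.toAdelic F E c N (TV.map (algebraMap F E))).range))
        [IsFiniteMeasure ν] [ν.IsOpenPosMeasure]
        [SMulInvariantMeasure (UnitaryGroup.adelic F E c N (TV.map (algebraMap F E)))
          (UnitaryGroup.adelic F E c N (TV.map (algebraMap F E)) ⧸ (UnitaryGroup.toAdelic F E c N (TV.map (algebraMap F E))).range) ν]
        [MeasurableSpace (AdeleRing (𝓞 F) F)] [BorelSpace (AdeleRing (𝓞 F) F)]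
        (νX : Measure (Fin n → AdeleRing (𝓞 F) F)) [νX.IsAddHaarMeasure]
        (hiso : ∀ (p : UnitaryGroup.adelic F E c N (TV.map (algebraMap F E)) × UnitaryGroup.adelic F E c 1 (TW.map (algebraMap F E)))
            (Φ : piSchwartzBruhat F (Fin n)),
          ∫⁻ x, ‖((pairRep F E c N 1 e (TV.map (algebraMap F E)) (TW.map (algebraMap F E)) s) p Φ :
              (Fin n → AdeleRing (𝓞 F) F) → ℂ) x‖ₑ ^ 2 ∂νX =
            ∫⁻ x, ‖(Φ : (Fin n → AdeleRing (𝓞 F) F) → ℂ) x‖ₑ ^ 2 ∂νX),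
        2 < N →
          ∃ κ : ℝ, 0 < κ ∧ ∀ Ψ : piSchwartzBruhat F (Fin (n + n)),
            Summable (eisSection (actRat F N e TV hVd TW hWd) (ratDoubledW F E c hcδ hδ hd N e TV hV hVd TW hW hWd)
                (stabDiagRat F N e TV hVd TW hWd) (ev0 F N e TV hVd TW hWd) Ψ) ∧
            doubledThetaIntegral F E c hcδ hδ hd N e TV hV hVd TW hW hWd ν Ψ =
              (κ : ℂ) * eis (actRat F N e TV hVd TW hWd) (ratDoubledW F E c hcδ hδ hd N e TV hV hVd TW hW hWd) (stabDiagRat F N e TV hVd TW hWd) (ev0 F N e TV hVd TW hWd) Ψ) :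
    Literature.NumberTheory.Li1992.KernelRallisIdentityUnitaryRankOneCM := by
  intro F E _ _ _ _ _ c N n e JV JW TV TW _ _ _ τ hτ δ hcδ hδ d hd hV hW hVd hWd hJV hJW _ _ s hs hρ SK hSK _ _ νX _ _ _ _ _ ν _ _ _ hiso hF hN
  subst hJV hJW
  -- the ★ closers at this datum, through their §0 re-spellings (SW0 is fed into SW1; `(τ, hτ)`, the CM instances and `hF` go to SW2 only)
  have H0 := sw0_diagChar F E c N e hcδ hδ hd hV hW hVd hWd s hs νX hiso
  have H1 := sw1_seesawKernel F E c N e hcδ hδ hd hV hW hVd hWd s hs hρ SK hSK ν H0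
  have hC := sw2i_carrier F N e hVd hWd
  have hunif := sw2ii_orbitalSums F E c N e hcδ hδ hd hV hW hVd hWd s hs νX hiso hF
  obtain ⟨κ, hκ, hSW⟩ := hSW F E c N e τ hτ hcδ hδ hd hV hW hVd hWd s hs ν νX hiso hN
  obtain ⟨m, hbij, hequiv⟩ := sw3_orbit F E c N e hcδ hδ hd hV hW hVd hWd s hs hN
  obtain ⟨c₀, hc₀, hval⟩ := sw4_sectionValue F N e hVd hWd νX
  -- `ω(1,y) ω(1,y') = ω(1,yy')` and the POLARISED unitarity `⟨ω(1,y)A, ω(1,y)B⟩ = ⟨A, B⟩` (★ `schwartzPairing_pairRep_pairRep`)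
  have hωmul : ∀ (y y' : UnitaryGroup.adelic F E c 1 (TW.map (algebraMap F E))) (Φ : piSchwartzBruhat F (Fin n)),
      (pairRep F E c N 1 e (TV.map (algebraMap F E)) (TW.map (algebraMap F E)) s) (1, y) ((pairRep F E c N 1 e (TV.map (algebraMap F E)) (TW.map (algebraMap F E)) s) (1, y') Φ) = (pairRep F E c N 1 e (TV.map (algebraMap F E)) (TW.map (algebraMap F E)) s) (1, y * y') Φ := fun y y' Φ => by
    rw [← Module.End.mul_apply, ← map_mul, Prod.mk_mul_mk, one_mul]
  have hpol : ∀ (y : UnitaryGroup.adelic F E c 1 (TW.map (algebraMap F E))) (A B : piSchwartzBruhat F (Fin n)), schwartzPairing F (Fin n) νX ((pairRep F E c N 1 e (TV.map (algebraMap F E)) (TW.map (algebraMap F E)) s) (1, y) A) ((pairRep F E c N 1 e (TV.map (algebraMap F E)) (TW.map (algebraMap F E)) s) (1, y) B) = schwartzPairing F (Fin n) νX A B :=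
    fun y A B => schwartzPairing_pairRep_pairRep F E c N 1 e (TV.map (algebraMap F E)) (TW.map (algebraMap F E)) s νX hiso (1, y) A B
  unfold ThetaKernelDatum.KernelRallisIdentity
  refine ⟨κ * c₀, mul_pos hκ hc₀, fun Φ₁ Φ₂ => ?_⟩
  -- R0: the orbit term in the word `x₂γx₁⁻¹` IS the pairing of the translated vectors
  have hword : ∀ (γ x₁ x₂ : UnitaryGroup.adelic F E c 1 (TW.map (algebraMap F E))),
      schwartzPairing F (Fin n) νX ((pairRep F E c N 1 e (TV.map (algebraMap F E)) (TW.map (algebraMap F E)) s) (1, x₂ * γ * x₁⁻¹) Φ₁) Φ₂ = schwartzPairing F (Fin n) νX ((pairRep F E c N 1 e (TV.map (algebraMap F E)) (TW.map (algebraMap F E)) s) (1, γ) ((pairRep F E c N 1 e (TV.map (algebraMap F E)) (TW.map (algebraMap F E)) s) (1, x₁⁻¹) Φ₁)) ((pairRep F E c N 1 e (TV.map (algebraMap F E)) (TW.map (algebraMap F E)) s) (1, x₂⁻¹) Φ₂) := fun γ x₁ x₂ => by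
    rw [← hpol x₂ ((pairRep F E c N 1 e (TV.map (algebraMap F E)) (TW.map (algebraMap F E)) s) (1, γ) ((pairRep F E c N 1 e (TV.map (algebraMap F E)) (TW.map (algebraMap F E)) s) (1, x₁⁻¹) Φ₁)) ((pairRep F E c N 1 e (TV.map (algebraMap F E)) (TW.map (algebraMap F E)) s) (1, x₂⁻¹) Φ₂), hωmul, hωmul, hωmul, mul_inv_cancel, Prod.mk_one_one,
      map_one, Module.End.one_apply]
  -- BOUND: J-E2-2 (SW2 (ii), on compacta of `G × G`) descended to ONE bound on `G × G` (★ `OrbitSumDescent`)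
  have hloc : ∀ C : Set (UnitaryGroup.adelic F E c 1 (TW.map (algebraMap F E)) × UnitaryGroup.adelic F E c 1 (TW.map (algebraMap F E))), IsCompact C → ∃ B : ℝ, ∀ x₁ x₂ : UnitaryGroup.adelic F E c 1 (TW.map (algebraMap F E)), (x₁, x₂) ∈ C →
      Summable (fun γ : ↥(UnitaryGroup.toAdelic F E c 1 (TW.map (algebraMap F E))).range => ‖schwartzPairing F (Fin n) νX ((pairRep F E c N 1 e (TV.map (algebraMap F E)) (TW.map (algebraMap F E)) s) (1, x₂ * (γ : UnitaryGroup.adelic F E c 1 (TW.map (algebraMap F E))) * x₁⁻¹) Φ₁) Φ₂‖) ∧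
        ∑' γ : ↥(UnitaryGroup.toAdelic F E c 1 (TW.map (algebraMap F E))).range, ‖schwartzPairing F (Fin n) νX ((pairRep F E c N 1 e (TV.map (algebraMap F E)) (TW.map (algebraMap F E)) s) (1, x₂ * (γ : UnitaryGroup.adelic F E c 1 (TW.map (algebraMap F E))) * x₁⁻¹) Φ₁) Φ₂‖ ≤ B := by
    intro C hCc
    obtain ⟨B, hB⟩ := hunif Φ₁ Φ₂ C hCc
    refine ⟨B, fun x₁ x₂ hx => ?_⟩
    simp only [hword]
    exact hB x₁ x₂ hx
  obtain ⟨B, hB⟩ := OrbitSumDescent.orbitSum_global_bound_of_compacta ((UnitaryGroup.toAdelic F E c 1 (TW.map (algebraMap F E))).range)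
    (fun g : UnitaryGroup.adelic F E c 1 (TW.map (algebraMap F E)) => schwartzPairing F (Fin n) νX ((pairRep F E c N 1 e (TV.map (algebraMap F E)) (TW.map (algebraMap F E)) s) (1, g) Φ₁) Φ₂) hloc
  refine ⟨B, fun x₁ x₂ => ?_⟩
  obtain ⟨hsum, hle⟩ := hB x₁ x₂
  -- the target's `M.W.act (M.s (1, h)) Φ` is `ω (1, h) Φ` by `rfl`: ONE `show`, then everything is syntactic
  show Summable (fun γ : ↥(UnitaryGroup.toAdelic F E c 1 (TW.map (algebraMap F E))).range => ‖schwartzPairing F (Fin n) νX ((pairRep F E c N 1 e (TV.map (algebraMap F E)) (TW.map (algebraMap F E)) s) (1, x₂ * (γ : UnitaryGroup.adelic F E c 1 (TW.map (algebraMap F E))) * x₁⁻¹) Φ₁) Φ₂‖) ∧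
      ∑' γ : ↥(UnitaryGroup.toAdelic F E c 1 (TW.map (algebraMap F E))).range, ‖schwartzPairing F (Fin n) νX ((pairRep F E c N 1 e (TV.map (algebraMap F E)) (TW.map (algebraMap F E)) s) (1, x₂ * (γ : UnitaryGroup.adelic F E c 1 (TW.map (algebraMap F E))) * x₁⁻¹) Φ₁) Φ₂‖ ≤ B ∧
        (thetaKernelDatum F E c N 1 e (TV.map (algebraMap F E)) (TW.map (algebraMap F E)) hcδ hδ hd hV hW hVd hWd rfl rfl s hs hρ SK hSK).innerKernel ν Φ₁ Φ₂ (x₁ : UnitaryGroup.adelic F E c 1 (TW.map (algebraMap F E)) ⧸ (UnitaryGroup.toAdelic F E c 1 (TW.map (algebraMap F E))).range) (x₂ : UnitaryGroup.adelic F E c 1 (TW.map (algebraMap F E)) ⧸ (UnitaryGroup.toAdelic F E c 1 (TW.map (algebraMap F E))).range) =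
          ((κ * c₀ : ℝ) : ℂ) * ∑' γ : ↥(UnitaryGroup.toAdelic F E c 1 (TW.map (algebraMap F E))).range, schwartzPairing F (Fin n) νX ((pairRep F E c N 1 e (TV.map (algebraMap F E)) (TW.map (algebraMap F E)) s) (1, x₂ * (γ : UnitaryGroup.adelic F E c 1 (TW.map (algebraMap F E))) * x₁⁻¹) Φ₁) Φ₂
  refine ⟨hsum, hle, ?_⟩
  -- IDENTITY.  KEY: the Eisenstein section of `Ψ` at the coset of `m γ` is `c₀ · ⟨ω(x₂γ⁻¹x₁⁻¹)Φ₁, Φ₂⟩`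
  have key : ∀ γ : ↥(UnitaryGroup.toAdelic F E c 1 (TW.map (algebraMap F E))).range, (eisSection (actRat F N e TV hVd TW hWd) (ratDoubledW F E c hcδ hδ hd N e TV hV hVd TW hW hWd) (stabDiagRat F N e TV hVd TW hWd) (ev0 F N e TV hVd TW hWd) (boxConj F ((pairRep F E c N 1 e (TV.map (algebraMap F E)) (TW.map (algebraMap F E)) s) (1, x₁⁻¹) Φ₁) ((pairRep F E c N 1 e (TV.map (algebraMap F E)) (TW.map (algebraMap F E)) s) (1, x₂⁻¹) Φ₂))) ((Equiv.ofBijective _ hbij) γ) = (c₀ : ℂ) * schwartzPairing F (Fin n) νX ((pairRep F E c N 1 e (TV.map (algebraMap F E)) (TW.map (algebraMap F E)) s) (1, x₂ * ((γ⁻¹ : ↥(UnitaryGroup.toAdelic F E c 1 (TW.map (algebraMap F E))).range) : UnitaryGroup.adelic F E c 1 (TW.map (algebraMap F E))) * x₁⁻¹) Φ₁) Φ₂ := by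
    intro γ
    obtain ⟨p, hp⟩ := QuotientGroup.mk_out_eq_mul ((stabDiagRat F N e TV hVd TW hWd).subgroupOf (ratDoubledW F E c hcδ hδ hd N e TV hV hVd TW hW hWd)) (m γ)
    have hout : (Quotient.out ((Equiv.ofBijective _ hbij) γ) : ratDoubledW F E c hcδ hδ hd N e TV hV hVd TW hW hWd) = m γ * p := hp
    have hpP : ((p : ratDoubledW F E c hcδ hδ hd N e TV hV hVd TW hW hWd) : Matrix.symplecticGroup (Fin (n + n)) F)⁻¹ ∈ stabDiagRat F N e TV hVd TW hWd := (stabDiagRat F N e TV hVd TW hWd).inv_mem (Subgroup.mem_subgroupOf.1 p.2)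
    -- equivariance (SW3) for `(m γ)⁻¹`
    have hinv : actRat F N e TV hVd TW hWd ((m γ : ratDoubledW F E c hcδ hδ hd N e TV hV hVd TW hW hWd) : Matrix.symplecticGroup (Fin (n + n)) F)⁻¹ ((boxConj F ((pairRep F E c N 1 e (TV.map (algebraMap F E)) (TW.map (algebraMap F E)) s) (1, x₁⁻¹) Φ₁) ((pairRep F E c N 1 e (TV.map (algebraMap F E)) (TW.map (algebraMap F E)) s) (1, x₂⁻¹) Φ₂))) =
        boxConj F ((pairRep F E c N 1 e (TV.map (algebraMap F E)) (TW.map (algebraMap F E)) s) (1, (γ : UnitaryGroup.adelic F E c 1 (TW.map (algebraMap F E)))⁻¹ * x₁⁻¹) Φ₁) ((pairRep F E c N 1 e (TV.map (algebraMap F E)) (TW.map (algebraMap F E)) s) (1, x₂⁻¹) Φ₂) := by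
      have h := hequiv γ ((pairRep F E c N 1 e (TV.map (algebraMap F E)) (TW.map (algebraMap F E)) s) (1, (γ : UnitaryGroup.adelic F E c 1 (TW.map (algebraMap F E)))⁻¹ * x₁⁻¹) Φ₁) ((pairRep F E c N 1 e (TV.map (algebraMap F E)) (TW.map (algebraMap F E)) s) (1, x₂⁻¹) Φ₂)
      rw [hωmul, ← mul_assoc, mul_inv_cancel, one_mul] at h
      rw [← h, actRat_inv_actRat]
    unfold eisSection
    rw [hout, Subgroup.coe_mul, mul_inv_rev, actRat_mul, hC.ev0_act_P _ hpP, hinv, hval, ← hωmul, ← hword, Subgroup.coe_inv]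
  have hsumEq : ∑' q, (eisSection (actRat F N e TV hVd TW hWd) (ratDoubledW F E c hcδ hδ hd N e TV hV hVd TW hW hWd) (stabDiagRat F N e TV hVd TW hWd) (ev0 F N e TV hVd TW hWd) (boxConj F ((pairRep F E c N 1 e (TV.map (algebraMap F E)) (TW.map (algebraMap F E)) s) (1, x₁⁻¹) Φ₁) ((pairRep F E c N 1 e (TV.map (algebraMap F E)) (TW.map (algebraMap F E)) s) (1, x₂⁻¹) Φ₂))) q = (c₀ : ℂ) * ∑' γ : ↥(UnitaryGroup.toAdelic F E c 1 (TW.map (algebraMap F E))).range, schwartzPairing F (Fin n) νX ((pairRep F E c N 1 e (TV.map (algebraMap F E)) (TW.map (algebraMap F E)) s) (1, x₂ * (γ : UnitaryGroup.adelic F E c 1 (TW.map (algebraMap F E))) * x₁⁻¹) Φ₁) Φ₂ :=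
    calc ∑' q, (eisSection (actRat F N e TV hVd TW hWd) (ratDoubledW F E c hcδ hδ hd N e TV hV hVd TW hW hWd) (stabDiagRat F N e TV hVd TW hWd) (ev0 F N e TV hVd TW hWd) (boxConj F ((pairRep F E c N 1 e (TV.map (algebraMap F E)) (TW.map (algebraMap F E)) s) (1, x₁⁻¹) Φ₁) ((pairRep F E c N 1 e (TV.map (algebraMap F E)) (TW.map (algebraMap F E)) s) (1, x₂⁻¹) Φ₂))) q = ∑' γ : ↥(UnitaryGroup.toAdelic F E c 1 (TW.map (algebraMap F E))).range, (eisSection (actRat F N e TV hVd TW hWd) (ratDoubledW F E c hcδ hδ hd N e TV hV hVd TW hW hWd) (stabDiagRat F N e TV hVd TW hWd) (ev0 F N e TV hVd TW hWd) (boxConj F ((pairRep F E c N 1 e (TV.map (algebraMap F E)) (TW.map (algebraMap F E)) s) (1, x₁⁻¹) Φ₁) ((pairRep F E c N 1 e (TV.map (algebraMap F E)) (TW.map (algebraMap F E)) s) (1, x₂⁻¹) Φ₂))) ((Equiv.ofBijective _ hbij) γ) := (Equiv.tsum_eq ((Equiv.ofBijective _ hbij)) ((eisSection (actRat F N e TV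 hVd TW hWd) (ratDoubledW F E c hcδ hδ hd N e TV hV hVd TW hW hWd) (stabDiagRat F N e TV hVd TW hWd) (ev0 F N e TV hVd TW hWd) (boxConj F ((pairRep F E c N 1 e (TV.map (algebraMap F E)) (TW.map (algebraMap F E)) s) (1, x₁⁻¹) Φ₁) ((pairRep F E c N 1 e (TV.map (algebraMap F E)) (TW.map (algebraMap F E)) s) (1, x₂⁻¹) Φ₂))))).symm
      _ = ∑' γ : ↥(UnitaryGroup.toAdelic F E c 1 (TW.map (algebraMap F E))).range, (eisSection (actRat F N e TV hVd TW hWd) (ratDoubledW F E c hcδ hδ hd N e TV hV hVd TW hW hWd) (stabDiagRat F N e TV hVd TW hWd) (ev0 F N e TV hVd TW hWd) (boxConj F ((pairRep F E c N 1 e (TV.map (algebraMap F E)) (TW.map (algebraMap F E)) s) (1, x₁⁻¹) Φ₁) ((pairRep F E c N 1 e (TV.map (algebraMap F E)) (TW.map (algebraMap F E)) s) (1, x₂⁻¹) Φ₂))) ((Equiv.ofBijective _ hbij) γ⁻¹) := (Equiv.tsum_eq (Equiv.inv (↥(UnitaryGroup.toAdelic F E c 1 (TW.map (algebraMap F E))).range))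 (fun γ : ↥(UnitaryGroup.toAdelic F E c 1 (TW.map (algebraMap F E))).range => (eisSection (actRat F N e TV hVd TW hWd) (ratDoubledW F E c hcδ hδ hd N e TV hV hVd TW hW hWd) (stabDiagRat F N e TV hVd TW hWd) (ev0 F N e TV hVd TW hWd) (boxConj F ((pairRep F E c N 1 e (TV.map (algebraMap F E)) (TW.map (algebraMap F E)) s) (1, x₁⁻¹) Φ₁) ((pairRep F E c N 1 e (TV.map (algebraMap F E)) (TW.map (algebraMap F E)) s) (1, x₂⁻¹) Φ₂))) ((Equiv.ofBijective _ hbij) γ))).symm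
      _ = ∑' γ : ↥(UnitaryGroup.toAdelic F E c 1 (TW.map (algebraMap F E))).range, (c₀ : ℂ) * schwartzPairing F (Fin n) νX ((pairRep F E c N 1 e (TV.map (algebraMap F E)) (TW.map (algebraMap F E)) s) (1, x₂ * (γ : UnitaryGroup.adelic F E c 1 (TW.map (algebraMap F E))) * x₁⁻¹) Φ₁) Φ₂ :=
          tsum_congr fun γ => by rw [key γ⁻¹, inv_inv]
      _ = (c₀ : ℂ) * ∑' γ : ↥(UnitaryGroup.toAdelic F E c 1 (TW.map (algebraMap F E))).range, schwartzPairing F (Fin n) νX ((pairRep F E c N 1 e (TV.map (algebraMap F E)) (TW.map (algebraMap F E)) s) (1, x₂ * (γ : UnitaryGroup.adelic F E c 1 (TW.map (algebraMap F E))) * x₁⁻¹) Φ₁) Φ₂ := tsum_mul_left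
  rw [H1 Φ₁ Φ₂ x₁ x₂, (hSW _).2, eis, hsumEq, Complex.ofReal_mul, mul_assoc]

end Summit.HodgeConjecture.HodgeConjecture.Cruxes.H413.E2SiegelWeil

end
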